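import Summits.BirchSwinnertonDyer.Rank1Residual.P2.CongruentClassSevenConfigurations
import HarnessLib

/-!
# Sub-lane «bsd-p2»: Monsky's odd matrix READ ON A LEGENDRE CONFIGURATION and the finite census of the
# `ρ`-free DOOR A at `ω(n) = 3` (classes `n ≡ 5, 7 (mod 8)`) — file 1/2 of the ATLAS-A3 pair
# (p2-typer GEN 6; GEN 5 HANDOFF NEXT (a) 'uniform `ω = 3` sub-families of DOOR A, `ρ`-free')

HONEST FRAMING (sub-lane «bsd-p2», run/shared/lean/b2b/bsd-rank1-residual/p2/, verbatim in every
file): the target of record is the FULL Birch–Swinnerton-Dyer formula for EVERY analytic-rank `≤ 1`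
`E/ℚ` at ALL primes INCLUDING `2`; the odd-prime class ledger is referee A's; the `2`-part is OPEN
(cells O1 = X5 ∖ CM and O12 = the CM corner) and under census by «bsd-p2». Census / instrument
output at `2` = EVIDENCE / conjecture items with held-out validation, NEVER a Literature fact;
certificates close PAIRS (one isogeny class, `p = 2`), never classes. This file asserts NO
arithmetic fact; it contains only COMPUTABLE DEFINITIONS (matrices over `𝔽₂` and `Bool` predicates
read on a configuration, in the style of `CongruentClassSevenConfigurations.lean`) and finite
statements decided by `decide`; nothing here mentions a prime.

WHAT IT DOES. The discharged `ρ`-free DOOR A (`bsdp_two_congruentNumberCurve_of_genusPointData`,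
`P2/CongruentNumberPairsAtTwoGenusPointData.lean`): `n = p₁⋯p_k ≡ 5, 7 (mod 8)`, Monsky kernel `2`
(`s(n) = 1`), `Σ₁(n)` odd or `Σ₂′(n)` odd ⟹ `r_an = 1`, rank `1`, `Ш[2^∞] = 0`, `BSD(E_n, 2)`. Both inputs
are functions of the LEGENDRE CONFIGURATION of the prime tuple (`rᵢ = pᵢ mod 8`, `β a b = [(p_b/p_a) = −1]`):
p2-monsky-lit's §1 readings `gBitCfg / sigma1Cfg / sigma2Cfg / betaOf` give `g(d) mod 2` and the genus
sums at `ω(n) = 3`; §1 here adds Monsky's odd matrix `monskyCfgOdd` (`A` = the bits with row sums,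
`D₂ = diag χ₈(rᵢ)`, `D₋₂ = diag (χ₈ + χ₄)(rᵢ)`; any number of primes) and the `Bool` predicates `doorACfg`
(= `r₀r₁r₂ ≡ 5, 7 (8)` ∧ `#ker monskyCfgOdd = 2` ∧ (`Σ₁ ≡ 1` ∨ `Σ₂ + g(n) ≡ 1`)) and `exceptionalFiveCfg`.
§2 is the FINITE CENSUS over the `4³·2³ = 512` ordered configurations of three odd primes (`256` with
`r₀r₁r₂ ≡ 5, 7 (mod 8)`; desk count of the typer, `p2/typer/cn/atlas3.py`: Monsky kernel `2` on `186` =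
`94` (class `5`) + `92` (class `7`); door on `180 = 88 + 92`), decided block by block (one `decide` per
class and leading residue `r₀`, `32` kernel counts each):
* `sigmaCfg_of_card_ker_seven` — CLASS `7`: Monsky kernel `2` ALONE implies `Σ₁ ≡ 1 ∨ Σ₂′ ≡ 1` (all `92`);
* `sigmaCfg_iff_of_card_ker_five` — CLASS `5`: given kernel `2`, the genus condition holds iff the
  configuration is NOT `exceptionalFiveCfg` = the single family `p₅·q₇·r₇` with `(q/p) = (r/p) = −1`,
  `(r/q)` free (`6` ordered configurations), on which `Σ₁`, `Σ₂′` are both even and Tian–Yuan–Zhang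
  Thm 1.2 / U⁺ is SILENT (nothing claimed there; a named target for the ideation seats).
That the REAL Monsky matrix / genus sums of a prime triple equal these readings, and the door
corollaries, are file 2/2 (`CongruentNumberPairsAtTwoDoorAAtlasThree.lean`). Nothing booked; no mark
moved. Unit `b2b-bsdres-p2-typer` GEN 6; NEW file.

References: [HeathBrown1994SelmerCongruentII] Appendix (Monsky), typescript p. 39 L10–L33;
[TianYuanZhang2017] Thm 1.2, §1; [IrelandRosen1990] Ch. 5 §1 Prop. 5.1.2–5.1.3, §2 Thm 1;
[LiMa2008] Thm 0.4; HOME/p2/typer/TYPING-PLAN.md v1.3 (ATLAS-A3).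
-/

open Matrix Finset

set_option autoImplicit false

namespace Summit.BirchSwinnertonDyer.Rank1Residual.P2

/-! ## §1 Monsky's odd matrix and DOOR A read on a configuration (computable) -/

section Config

variable {t : ℕ}

/-- Monsky's `A` read on a configuration: off the diagonal the bit `β i j = [(p_j/p_i) = −1]`, on the
diagonal the row sum (the diagonal of `β` is never read).
[cite: HeathBrown1994SelmerCongruentII, Appendix (Monsky), typescript p. 39 L13–L26] -/
def legendreCfg (β : Fin t → Fin t → ZMod 2) : Matrix (Fin t) (Fin t) (ZMod 2) :=
  Matrix.of fun i j => if i = j then ∑ l ∈ univ.erase i, β i l else β i j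

/-- Monsky's matrix `M = (A + D₂, D₂; D₂, A + D₋₂)` for odd `n = p₁⋯p_t` read on a configuration
(`rᵢ = pᵢ mod 8`): `D₂ = diag χ₈(rᵢ)` (`[(2/p) = −1] = [p ≡ ±3 (8)]`), `D₋₂ = diag (χ₈ + χ₄)(rᵢ)`
(`[(−2/p) = −1] = [(2/p) = −1] + [p ≡ 3 (4)]`).
[cite: HeathBrown1994SelmerCongruentII, Appendix (Monsky), typescript p. 39 L27–L32]
[cite: IrelandRosen1990, Ch. 5 §1 Prop. 5.1.2–5.1.3] -/
def monskyCfgOdd (r : Fin t → ℕ) (β : Fin t → Fin t → ZMod 2) :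
    Matrix (Fin t ⊕ Fin t) (Fin t ⊕ Fin t) (ZMod 2) :=
  Matrix.fromBlocks (legendreCfg β + Matrix.diagonal fun i => chi8Bit (r i))
    (Matrix.diagonal fun i => chi8Bit (r i)) (Matrix.diagonal fun i => chi8Bit (r i))
    (legendreCfg β + Matrix.diagonal fun i => chi8Bit (r i) + chi4Bit (r i))

/-- **DOOR A read on a configuration of three odd primes** (a `Bool`, so that it is not a `Prop`-valued
definition): `r₀r₁r₂ ≡ 5, 7 (mod 8)`, Monsky's matrix has a `2`-element kernel (`s(n) = 1`), and
`Σ₁ ≡ 1` or `Σ₂′ = Σ₂ + g(n) ≡ 1 (mod 2)` (readings `sigma1Cfg`, `sigma2Cfg`, `gBitSub`).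
[cite: TianYuanZhang2017, Thm. 1.2 and §1 (1.1)] [cite: HeathBrown1994SelmerCongruentII, Appendix (Monsky), typescript p. 39 L33] -/
def doorACfg (r : Fin 3 → ℕ) (β : Fin 3 → Fin 3 → ZMod 2) : Bool :=
  ((r 0 * r 1 * r 2) % 8 == 5 || (r 0 * r 1 * r 2) % 8 == 7) &&
  decide (Fintype.card {v : Fin 3 ⊕ Fin 3 → ZMod 2 // monskyCfgOdd r β *ᵥ v = 0} = 2) &&
  (decide (sigma1Cfg r β = 1) || decide (sigma2Cfg r β + gBitSub ![0, 1, 2] r β = 1))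

/-- The exceptional class-`5` configuration family at `ω = 3` (a `Bool`): some `pᵢ ≡ 5 (mod 8)`, the two
other primes `≡ 7 (mod 8)` and both quadratic NON-residues modulo `pᵢ` (`β i j = 1`; as `pᵢ ≡ 1 (mod 4)`
the symbol is symmetric). [cite: TianYuanZhang2017, Thm. 1.2] [cite: IrelandRosen1990, Ch. 5 §2 Thm. 1] -/
def exceptionalFiveCfg (r : Fin 3 → ℕ) (β : Fin 3 → Fin 3 → ZMod 2) : Bool :=
  decide (∃ i : Fin 3, r i % 8 = 5 ∧ ∀ j : Fin 3, j ≠ i → r j % 8 = 7 ∧ β i j = 1)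

/-- Unfolding of `doorACfg` into its three clauses. [cite: TianYuanZhang2017, Thm. 1.2 and §1 (1.1)] -/
theorem doorACfg_eq_true_iff (r : Fin 3 → ℕ) (β : Fin 3 → Fin 3 → ZMod 2) :
    doorACfg r β = true ↔
      ((r 0 * r 1 * r 2) % 8 = 5 ∨ (r 0 * r 1 * r 2) % 8 = 7) ∧
      Fintype.card {v : Fin 3 ⊕ Fin 3 → ZMod 2 // monskyCfgOdd r β *ᵥ v = 0} = 2 ∧
      (sigma1Cfg r β = 1 ∨ sigma2Cfg r β + gBitSub ![0, 1, 2] r β = 1) := by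
  simp only [doorACfg, Bool.and_eq_true, Bool.or_eq_true, beq_iff_eq, decide_eq_true_eq, and_assoc]

end Config

/-! ## §2 The finite census at `ω(n) = 3` (configurations = residues `rᵢ : Fin 8`, upper symbol bits
`s₀ = β 0 1`, `s₁ = β 0 2`, `s₂ = β 1 2`, the lower ones by reciprocity through `betaOf`; one `decide` per
class and leading residue — the even values of `r₀` are vacuous) -/

section Census

/-- Class `7`, `r₀ ≡ 1 (mod 8)`: kernel `2` ⟹ `Σ₁ ≡ 1 ∨ Σ₂′ ≡ 1` (`32` configurations). `decide`.
[cite: TianYuanZhang2017, Thm. 1.2] [cite: HeathBrown1994SelmerCongruentII, Appendix (Monsky), typescript p. 39 L27–L33] -/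
theorem sigmaCfg_of_card_ker_seven_one : ∀ (r₁ r₂ : Fin 8) (s₀ s₁ s₂ : ZMod 2),
    (1 * r₁.val * r₂.val) % 8 = 7 →
    Fintype.card {v : Fin 3 ⊕ Fin 3 → ZMod 2 //
      monskyCfgOdd ![1, r₁.val, r₂.val] (betaOf ![1, r₁.val, r₂.val] ![s₀, s₁, s₂]) *ᵥ v = 0} = 2 →
    (sigma1Cfg ![1, r₁.val, r₂.val] (betaOf ![1, r₁.val, r₂.val] ![s₀, s₁, s₂]) = 1 ∨
      sigma2Cfg ![1, r₁.val, r₂.val] (betaOf ![1, r₁.val, r₂.val] ![s₀, s₁, s₂]) +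
        gBitSub ![0, 1, 2] ![1, r₁.val, r₂.val] (betaOf ![1, r₁.val, r₂.val] ![s₀, s₁, s₂]) = 1) := by
  decide

/-- Class `7`, `r₀ ≡ 3 (mod 8)`: kernel `2` ⟹ `Σ₁ ≡ 1 ∨ Σ₂′ ≡ 1` (`32` configurations). `decide`.
[cite: TianYuanZhang2017, Thm. 1.2] [cite: HeathBrown1994SelmerCongruentII, Appendix (Monsky), typescript p. 39 L27–L33] -/
theorem sigmaCfg_of_card_ker_seven_three : ∀ (r₁ r₂ : Fin 8) (s₀ s₁ s₂ : ZMod 2),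
    (3 * r₁.val * r₂.val) % 8 = 7 →
    Fintype.card {v : Fin 3 ⊕ Fin 3 → ZMod 2 //
      monskyCfgOdd ![3, r₁.val, r₂.val] (betaOf ![3, r₁.val, r₂.val] ![s₀, s₁, s₂]) *ᵥ v = 0} = 2 →
    (sigma1Cfg ![3, r₁.val, r₂.val] (betaOf ![3, r₁.val, r₂.val] ![s₀, s₁, s₂]) = 1 ∨
      sigma2Cfg ![3, r₁.val, r₂.val] (betaOf ![3, r₁.val, r₂.val] ![s₀, s₁, s₂]) +
        gBitSub ![0, 1, 2] ![3, r₁.val, r₂.val] (betaOf ![3, r₁.val, r₂.val] ![s₀, s₁, s₂]) = 1) := by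
  decide

/-- Class `7`, `r₀ ≡ 5 (mod 8)`: kernel `2` ⟹ `Σ₁ ≡ 1 ∨ Σ₂′ ≡ 1` (`32` configurations). `decide`.
[cite: TianYuanZhang2017, Thm. 1.2] [cite: HeathBrown1994SelmerCongruentII, Appendix (Monsky), typescript p. 39 L27–L33] -/
theorem sigmaCfg_of_card_ker_seven_five : ∀ (r₁ r₂ : Fin 8) (s₀ s₁ s₂ : ZMod 2),
    (5 * r₁.val * r₂.val) % 8 = 7 →
    Fintype.card {v : Fin 3 ⊕ Fin 3 → ZMod 2 //
      monskyCfgOdd ![5, r₁.val, r₂.val] (betaOf ![5, r₁.val, r₂.val] ![s₀, s₁, s₂]) *ᵥ v = 0} = 2 →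
    (sigma1Cfg ![5, r₁.val, r₂.val] (betaOf ![5, r₁.val, r₂.val] ![s₀, s₁, s₂]) = 1 ∨
      sigma2Cfg ![5, r₁.val, r₂.val] (betaOf ![5, r₁.val, r₂.val] ![s₀, s₁, s₂]) +
        gBitSub ![0, 1, 2] ![5, r₁.val, r₂.val] (betaOf ![5, r₁.val, r₂.val] ![s₀, s₁, s₂]) = 1) := by
  decide

/-- Class `7`, `r₀ ≡ 7 (mod 8)`: kernel `2` ⟹ `Σ₁ ≡ 1 ∨ Σ₂′ ≡ 1` (`32` configurations). `decide`.
[cite: TianYuanZhang2017, Thm. 1.2] [cite: HeathBrown1994SelmerCongruentII, Appendix (Monsky), typescript p. 39 L27–L33] -/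
theorem sigmaCfg_of_card_ker_seven_seven : ∀ (r₁ r₂ : Fin 8) (s₀ s₁ s₂ : ZMod 2),
    (7 * r₁.val * r₂.val) % 8 = 7 →
    Fintype.card {v : Fin 3 ⊕ Fin 3 → ZMod 2 //
      monskyCfgOdd ![7, r₁.val, r₂.val] (betaOf ![7, r₁.val, r₂.val] ![s₀, s₁, s₂]) *ᵥ v = 0} = 2 →
    (sigma1Cfg ![7, r₁.val, r₂.val] (betaOf ![7, r₁.val, r₂.val] ![s₀, s₁, s₂]) = 1 ∨
      sigma2Cfg ![7, r₁.val, r₂.val] (betaOf ![7, r₁.val, r₂.val] ![s₀, s₁, s₂]) +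
        gBitSub ![0, 1, 2] ![7, r₁.val, r₂.val] (betaOf ![7, r₁.val, r₂.val] ![s₀, s₁, s₂]) = 1) := by
  decide

/-- The residue product `r₀r₁r₂` is odd only if `r₀` is. [cite: IrelandRosen1990, Ch. 5 §1] -/
theorem odd_of_mul_mul_mod_eight {a b c m : ℕ} (h : (a * b * c) % 8 = m) (hm : m % 2 = 1) :
    a % 2 = 1 := by
  have h2 : (a * b * c) % 2 = 1 := by omega
  have hodd := Nat.odd_iff.mpr h2
  rw [Nat.odd_mul, Nat.odd_mul] at hodd
  exact Nat.odd_iff.mp hodd.1.1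

/-- **CLASS `7`, `ω = 3`: Monsky kernel `2` ALONE implies the door's genus condition** — on every ordered
configuration with `r₀r₁r₂ ≡ 7 (mod 8)` (`128`; kernel `2` on `92`): `#ker = 2 ⟹ Σ₁ ≡ 1 ∨ Σ₂′ ≡ 1`.
(p2-monsky-lit's `sigma_odd_of_card_ker_fjCfg_three'` derives the same conclusion from the Faulkner–James
kernel `#NS(G(−n)) = 4`; here the `2`-descent datum suffices.) Assembled from the four blocks above.
[cite: TianYuanZhang2017, Thm. 1.2] [cite: HeathBrown1994SelmerCongruentII, Appendix (Monsky), typescript p. 39 L27–L33] -/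
theorem sigmaCfg_of_card_ker_seven : ∀ (r₀ r₁ r₂ : Fin 8) (s₀ s₁ s₂ : ZMod 2),
    (r₀.val * r₁.val * r₂.val) % 8 = 7 →
    Fintype.card {v : Fin 3 ⊕ Fin 3 → ZMod 2 //
      monskyCfgOdd ![r₀.val, r₁.val, r₂.val] (betaOf ![r₀.val, r₁.val, r₂.val] ![s₀, s₁, s₂])
        *ᵥ v = 0} = 2 →
    (sigma1Cfg ![r₀.val, r₁.val, r₂.val] (betaOf ![r₀.val, r₁.val, r₂.val] ![s₀, s₁, s₂]) = 1 ∨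
      sigma2Cfg ![r₀.val, r₁.val, r₂.val] (betaOf ![r₀.val, r₁.val, r₂.val] ![s₀, s₁, s₂]) +
        gBitSub ![0, 1, 2] ![r₀.val, r₁.val, r₂.val]
          (betaOf ![r₀.val, r₁.val, r₂.val] ![s₀, s₁, s₂]) = 1) := by
  intro r₀ r₁ r₂ s₀ s₁ s₂ h7
  have hodd := odd_of_mul_mul_mod_eight h7 (by norm_num)
  fin_cases r₀
  · exact absurd hodd (by decide)
  · exact sigmaCfg_of_card_ker_seven_one r₁ r₂ s₀ s₁ s₂ h7
  · exact absurd hodd (by decide)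
  · exact sigmaCfg_of_card_ker_seven_three r₁ r₂ s₀ s₁ s₂ h7
  · exact absurd hodd (by decide)
  · exact sigmaCfg_of_card_ker_seven_five r₁ r₂ s₀ s₁ s₂ h7
  · exact absurd hodd (by decide)
  · exact sigmaCfg_of_card_ker_seven_seven r₁ r₂ s₀ s₁ s₂ h7

/-- Class `5`, `r₀ ≡ 1 (mod 8)`: kernel `2` ⟹ (`Σ₁ ≡ 1 ∨ Σ₂′ ≡ 1` iff not exceptional). `decide`.
[cite: TianYuanZhang2017, Thm. 1.2] [cite: HeathBrown1994SelmerCongruentII, Appendix (Monsky), typescript p. 39 L27–L33] -/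
theorem sigmaCfg_iff_of_card_ker_five_one : ∀ (r₁ r₂ : Fin 8) (s₀ s₁ s₂ : ZMod 2),
    (1 * r₁.val * r₂.val) % 8 = 5 →
    Fintype.card {v : Fin 3 ⊕ Fin 3 → ZMod 2 //
      monskyCfgOdd ![1, r₁.val, r₂.val] (betaOf ![1, r₁.val, r₂.val] ![s₀, s₁, s₂]) *ᵥ v = 0} = 2 →
    ((sigma1Cfg ![1, r₁.val, r₂.val] (betaOf ![1, r₁.val, r₂.val] ![s₀, s₁, s₂]) = 1 ∨
      sigma2Cfg ![1, r₁.val, r₂.val] (betaOf ![1, r₁.val, r₂.val] ![s₀, s₁, s₂]) +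
        gBitSub ![0, 1, 2] ![1, r₁.val, r₂.val] (betaOf ![1, r₁.val, r₂.val] ![s₀, s₁, s₂]) = 1) ↔
      exceptionalFiveCfg ![1, r₁.val, r₂.val] (betaOf ![1, r₁.val, r₂.val] ![s₀, s₁, s₂]) = false) := by
  decide

/-- Class `5`, `r₀ ≡ 3 (mod 8)`: kernel `2` ⟹ (`Σ₁ ≡ 1 ∨ Σ₂′ ≡ 1` iff not exceptional). `decide`.
[cite: TianYuanZhang2017, Thm. 1.2] [cite: HeathBrown1994SelmerCongruentII, Appendix (Monsky), typescript p. 39 L27–L33] -/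
theorem sigmaCfg_iff_of_card_ker_five_three : ∀ (r₁ r₂ : Fin 8) (s₀ s₁ s₂ : ZMod 2),
    (3 * r₁.val * r₂.val) % 8 = 5 →
    Fintype.card {v : Fin 3 ⊕ Fin 3 → ZMod 2 //
      monskyCfgOdd ![3, r₁.val, r₂.val] (betaOf ![3, r₁.val, r₂.val] ![s₀, s₁, s₂]) *ᵥ v = 0} = 2 →
    ((sigma1Cfg ![3, r₁.val, r₂.val] (betaOf ![3, r₁.val, r₂.val] ![s₀, s₁, s₂]) = 1 ∨
      sigma2Cfg ![3, r₁.val, r₂.val] (betaOf ![3, r₁.val, r₂.val] ![s₀, s₁, s₂]) +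
        gBitSub ![0, 1, 2] ![3, r₁.val, r₂.val] (betaOf ![3, r₁.val, r₂.val] ![s₀, s₁, s₂]) = 1) ↔
      exceptionalFiveCfg ![3, r₁.val, r₂.val] (betaOf ![3, r₁.val, r₂.val] ![s₀, s₁, s₂]) = false) := by
  decide

/-- Class `5`, `r₀ ≡ 5 (mod 8)`: kernel `2` ⟹ (`Σ₁ ≡ 1 ∨ Σ₂′ ≡ 1` iff not exceptional). `decide`.
[cite: TianYuanZhang2017, Thm. 1.2] [cite: HeathBrown1994SelmerCongruentII, Appendix (Monsky), typescript p. 39 L27–L33] -/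
theorem sigmaCfg_iff_of_card_ker_five_five : ∀ (r₁ r₂ : Fin 8) (s₀ s₁ s₂ : ZMod 2),
    (5 * r₁.val * r₂.val) % 8 = 5 →
    Fintype.card {v : Fin 3 ⊕ Fin 3 → ZMod 2 //
      monskyCfgOdd ![5, r₁.val, r₂.val] (betaOf ![5, r₁.val, r₂.val] ![s₀, s₁, s₂]) *ᵥ v = 0} = 2 →
    ((sigma1Cfg ![5, r₁.val, r₂.val] (betaOf ![5, r₁.val, r₂.val] ![s₀, s₁, s₂]) = 1 ∨
      sigma2Cfg ![5, r₁.val, r₂.val] (betaOf ![5, r₁.val, r₂.val] ![s₀, s₁, s₂]) +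
        gBitSub ![0, 1, 2] ![5, r₁.val, r₂.val] (betaOf ![5, r₁.val, r₂.val] ![s₀, s₁, s₂]) = 1) ↔
      exceptionalFiveCfg ![5, r₁.val, r₂.val] (betaOf ![5, r₁.val, r₂.val] ![s₀, s₁, s₂]) = false) := by
  decide

/-- Class `5`, `r₀ ≡ 7 (mod 8)`: kernel `2` ⟹ (`Σ₁ ≡ 1 ∨ Σ₂′ ≡ 1` iff not exceptional). `decide`.
[cite: TianYuanZhang2017, Thm. 1.2] [cite: HeathBrown1994SelmerCongruentII, Appendix (Monsky), typescript p. 39 L27–L33] -/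
theorem sigmaCfg_iff_of_card_ker_five_seven : ∀ (r₁ r₂ : Fin 8) (s₀ s₁ s₂ : ZMod 2),
    (7 * r₁.val * r₂.val) % 8 = 5 →
    Fintype.card {v : Fin 3 ⊕ Fin 3 → ZMod 2 //
      monskyCfgOdd ![7, r₁.val, r₂.val] (betaOf ![7, r₁.val, r₂.val] ![s₀, s₁, s₂]) *ᵥ v = 0} = 2 →
    ((sigma1Cfg ![7, r₁.val, r₂.val] (betaOf ![7, r₁.val, r₂.val] ![s₀, s₁, s₂]) = 1 ∨
      sigma2Cfg ![7, r₁.val, r₂.val] (betaOf ![7, r₁.val, r₂.val] ![s₀, s₁, s₂]) +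
        gBitSub ![0, 1, 2] ![7, r₁.val, r₂.val] (betaOf ![7, r₁.val, r₂.val] ![s₀, s₁, s₂]) = 1) ↔
      exceptionalFiveCfg ![7, r₁.val, r₂.val] (betaOf ![7, r₁.val, r₂.val] ![s₀, s₁, s₂]) = false) := by
  decide

/-- **CLASS `5`, `ω = 3`: given Monsky kernel `2`, the genus condition holds iff the configuration is NOT
the exceptional family** `p₅·q₇·r₇`, `(q/p) = (r/p) = −1` (`128` configurations; kernel `2` on `94`, genus
condition on `88`, exceptional `6`). Assembled from the four blocks above.
[cite: TianYuanZhang2017, Thm. 1.2] [cite: HeathBrown1994SelmerCongruentII, Appendix (Monsky), typescript p. 39 L27–L33] -/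
theorem sigmaCfg_iff_of_card_ker_five : ∀ (r₀ r₁ r₂ : Fin 8) (s₀ s₁ s₂ : ZMod 2),
    (r₀.val * r₁.val * r₂.val) % 8 = 5 →
    Fintype.card {v : Fin 3 ⊕ Fin 3 → ZMod 2 //
      monskyCfgOdd ![r₀.val, r₁.val, r₂.val] (betaOf ![r₀.val, r₁.val, r₂.val] ![s₀, s₁, s₂])
        *ᵥ v = 0} = 2 →
    ((sigma1Cfg ![r₀.val, r₁.val, r₂.val] (betaOf ![r₀.val, r₁.val, r₂.val] ![s₀, s₁, s₂]) = 1 ∨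
      sigma2Cfg ![r₀.val, r₁.val, r₂.val] (betaOf ![r₀.val, r₁.val, r₂.val] ![s₀, s₁, s₂]) +
        gBitSub ![0, 1, 2] ![r₀.val, r₁.val, r₂.val]
          (betaOf ![r₀.val, r₁.val, r₂.val] ![s₀, s₁, s₂]) = 1) ↔
      exceptionalFiveCfg ![r₀.val, r₁.val, r₂.val]
        (betaOf ![r₀.val, r₁.val, r₂.val] ![s₀, s₁, s₂]) = false) := by
  intro r₀ r₁ r₂ s₀ s₁ s₂ h5
  have hodd := odd_of_mul_mul_mod_eight h5 (by norm_num)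
  fin_cases r₀
  · exact absurd hodd (by decide)
  · exact sigmaCfg_iff_of_card_ker_five_one r₁ r₂ s₀ s₁ s₂ h5
  · exact absurd hodd (by decide)
  · exact sigmaCfg_iff_of_card_ker_five_three r₁ r₂ s₀ s₁ s₂ h5
  · exact absurd hodd (by decide)
  · exact sigmaCfg_iff_of_card_ker_five_five r₁ r₂ s₀ s₁ s₂ h5
  · exact absurd hodd (by decide)
  · exact sigmaCfg_iff_of_card_ker_five_seven r₁ r₂ s₀ s₁ s₂ h5

end Census

end Summit.BirchSwinnertonDyer.Rank1Residual.P2
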